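import Summits.ResolutionOfSingularities.ResolutionOfSingularities.Theorems.NearCutChartTaylor
import Literature.AlgebraicGeometry.Resolution.KrullAkizukiLemma
import Literature.AlgebraicGeometry.Resolution.AffineDomainEquidim
import Mathlib.RingTheory.Ideal.KrullsHeightTheorem
import Mathlib.RingTheory.Ideal.MinimalPrime.Noetherian
import Mathlib.RingTheory.Length
import HarnessLib

/-!
# NearCut §P3–§P5 (decomp-res lens-3 g23, PRIME SHEDDING part 2/3): curve primes over `multIdeal`, their existence
# when the multiplicity is not isolated, wall coordinates, contraction down the chain, dimension one and finiteness
# (Krull's principal ideal theorem + equidimensionality of affine domains), and the Krull–Akizuki monotonicity of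
# lengths `ℓ_B(B/f(a)B) ≤ ℓ_A(A/aA)` for a birational extension `A ↪ B ⊆ A[1/t]` of one-dimensional domains

Pure additions in namespace `Summit.ResolutionOfSingularities.ResolutionOfSingularities.Theorems.NearCut`; content =
node HOME/decomp-res-lens-3/g23/NearCut.lean §P3–§P5
verbatim (farm-checked inside the node: rc 0, 0 sorry, axioms standard).  See NODE-g23.md §2.

[WRITER NOTE (g11, gate dedup pre-flight): the node's copy `X_mem_idealOfVars` (Fin 3) is NOT re-landed — it is the landed
`Literature.RingTheory.MvPolynomial.X_mem_idealOfVars` (`IdealOfVarsBasics`, already in the import closure), aliased by an explicit `open … (…)`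
and cited by the same short name at its three uses.]
-/

noncomputable section

open MvPolynomial Finset
open Literature.AlgebraicGeometry.Resolution
open Literature.AlgebraicGeometry.Resolution.Hauser2010
open Literature.AlgebraicGeometry.Resolution.PointBlowup
open Summit.ResolutionOfSingularities.ResolutionOfSingularities.Theses
open Summit.ResolutionOfSingularities.ResolutionOfSingularities.Theorems.TightDefectClasses
open Summit.ResolutionOfSingularities.ResolutionOfSingularities.Theorems.TightDefectStrongWalks
open Summit.ResolutionOfSingularities.ResolutionOfSingularities.Theorems.ItineraryCutClasses
open Summit.ResolutionOfSingularities.ResolutionOfSingularities.Theorems.BoundaryLedger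
open Summit.ResolutionOfSingularities.ResolutionOfSingularities.Theorems.ProximityCut
open Summit.ResolutionOfSingularities.ResolutionOfSingularities.Theorems.ConeCutAxisLaw
open Literature.AlgebraicGeometry.Resolution.WeightedBlowup
open Literature.Barriers.ResolutionOfSingularities
open Summit.ResolutionOfSingularities.ResolutionOfSingularities.Theorems.FloorCut
open Summit.ResolutionOfSingularities.ResolutionOfSingularities.Theorems.ConeCut
open Summit.ResolutionOfSingularities.ResolutionOfSingularities.Theorems.ExitLaw (fin3_cases eq_of_le_of_degree_le)
open Summit.ResolutionOfSingularities.ResolutionOfSingularities.Theorems.ShadeCut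
open Summit.ResolutionOfSingularities.ResolutionOfSingularities.Theorems.TightCut
open Summit.ResolutionOfSingularities.ResolutionOfSingularities.Theorems.HoleCut
open Literature.RingTheory.MvPolynomial (X_mem_idealOfVars)

namespace Summit.ResolutionOfSingularities.ResolutionOfSingularities.Theorems.NearCut

/-! ### §P3 Curve primes: the multiplicity ideal under the chart homomorphism, existence, wall coordinates -/

section Primes

variable {K : Type} [Field K]

/-- `mem_idealOfVars_iff_constantCoeff`: Auxiliary step of the lens-3 g23 §P prime-shedding calculus, VERBATIM from
the lens file tree/NearCutCurvePrimes.lean (see the module docstring); the statement is its type. [folklore] -/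
theorem mem_idealOfVars_iff_constantCoeff (f : MvPolynomial (Fin 3) K) :
    f ∈ idealOfVars (Fin 3) K ↔ constantCoeff f = 0 := by
  rw [Literature.RingTheory.MvPolynomial.idealOfVars_eq_ker_constantCoeff, RingHom.mem_ker]

/-- `isMaximal_idealOfVars`: Auxiliary step of the lens-3 g23 §P prime-shedding calculus, VERBATIM from the lens
file tree/NearCutCurvePrimes.lean (see the module docstring); the statement is its type. [folklore] -/
theorem isMaximal_idealOfVars : (idealOfVars (Fin 3) K).IsMaximal := by
  rw [Literature.RingTheory.MvPolynomial.idealOfVars_eq_ker_constantCoeff]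
  exact RingHom.ker_isMaximal_of_surjective constantCoeff fun r => ⟨C r, constantCoeff_C _ r⟩

/-- The multiplicity ideal of an order-`s` hypersurface sits inside the ideal of the closed point. [folklore] -/
theorem multIdeal_le_idealOfVars {s : ℕ} {G : MvPolynomial (Fin 3) K} (hord : ordZero G = (s : ℕ∞)) :
    multIdeal s G ≤ idealOfVars (Fin 3) K := by
  refine Ideal.span_le.mpr ?_
  rintro _ ⟨d, hd, rfl⟩
  rw [SetLike.mem_coe, mem_idealOfVars_iff_constantCoeff, constantCoeff_hasseDeriv]
  exact ((ordZero_eq_nat_iff G s).mp hord).2 d hd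

/-- **Downward functoriality of the multiplicity ideal** (the kernel form of "the strict transform has order `≤ s`,
with equality only over the order-`s` locus", read backwards): if `σ G = y_j^s G'`, `P'` is a prime with `y_j ∉ P'`
and `multIdeal s G' ≤ P'`, then `multIdeal s G ≤ σ⁻¹ P'`.  Proof: Taylor chain rule `taylor (σ G) = Θ_σ (taylor G)`,
reduction modulo `P'` into `Frac(R/P')[u]`, and injectivity of the reduced substitution on `(u)^s`
(`mem_pow_idealOfVars_of_aeval_mem`).  [new] [folklore] -/
theorem multIdeal_le_comap_chartHom {s : ℕ} {j : Fin 3} {b : Fin 3 → K} (hb : b j = 0)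
    {G G' : MvPolynomial (Fin 3) K} (hG : chartHom j b G = X j ^ s * G')
    {P' : Ideal (MvPolynomial (Fin 3) K)} [hP' : P'.IsPrime] (hXj : X j ∉ P') (hI' : multIdeal s G' ≤ P') :
    multIdeal s G ≤ P'.comap (chartHom j b : MvPolynomial (Fin 3) K →+* MvPolynomial (Fin 3) K) := by
  classical
  set σ := chartHom j b with hσ
  set A := MvPolynomial (Fin 3) K ⧸ P'
  set L := FractionRing A
  set π : MvPolynomial (Fin 3) K →+* L := (algebraMap A L).comp (Ideal.Quotient.mk P') with hπdef
  have hπ : ∀ f, π f = 0 ↔ f ∈ P' := fun f => by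
    rw [hπdef, RingHom.comp_apply, map_eq_zero_iff _ (IsFractionRing.injective A L),
      Ideal.Quotient.eq_zero_iff_mem]
  set η : L := π (X j) with hη
  have hη0 : η ≠ 0 := fun h => hXj ((hπ _).mp h)
  set c : Fin 3 → L := fun i => π (X i + C (b i)) with hc
  -- the reduced Taylor substitution of `σ`
  have hψ : (fun i => MvPolynomial.map π (taylor K (σ (X i)) - C (σ (X i)))) =
      (fun i => if i = j then (X j : MvPolynomial (Fin 3) L) else C η * X i + C (c i) * X j + X j * X i) := by
    funext i
    by_cases hij : i = j
    · subst hij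
      rw [if_pos rfl, hσ, chartHom_X_self hb]
      simp
    · rw [if_neg hij, hσ, chartHom_X_of_ne hb hij]
      simp only [map_mul, map_add, taylor_X, taylor_C, map_sub, MvPolynomial.map_X, MvPolynomial.map_C, hη, hc,
        map_add]
      ring
  -- (1) the reduced Taylor expansion of `G'` lies in `(u)^s`
  have h1 : MvPolynomial.map π (taylor K G') ∈ idealOfVars (Fin 3) L ^ s := by
    rw [MvPolynomial.mem_pow_idealOfVars_iff']
    intro d hd
    rw [coeff_map, ← hasseDeriv_apply, hπ]
    exact hI' (Ideal.subset_span ⟨d, hd, rfl⟩)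
  -- (2) hence so does that of `σ G = y_j^s G'`
  have h2 : MvPolynomial.map π (taylor K (σ G)) ∈ idealOfVars (Fin 3) L ^ s := by
    rw [hσ, hG, map_mul, map_mul]
    exact Ideal.mul_mem_left _ _ h1
  -- (3) chain rule + reduction
  rw [taylor_comp_algHom, map_taylorMap, hψ] at h2
  have h4 := mem_pow_idealOfVars_of_aeval_mem j hη0 c s _ h2
  rw [MvPolynomial.mem_pow_idealOfVars_iff'] at h4
  -- conclusion
  refine Ideal.span_le.mpr ?_
  rintro _ ⟨d, hd, rfl⟩
  rw [SetLike.mem_coe, Ideal.mem_comap, RingHom.coe_coe, ← hπ]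
  show π (σ (hasseDeriv K d G)) = 0
  rw [hasseDeriv_apply,
    show π (σ (coeff d (taylor K G))) = coeff d (MvPolynomial.map (π.comp ↑σ) (taylor K G)) by
      rw [coeff_map]; rfl]
  exact h4 d hd

/-- The CURVE PRIMES of an order-`s` hypersurface germ: primes between the multiplicity ideal and the ideal of the
closed point, other than the closed point itself (the generic points of the branches of the order-`s` locus). -/
def curvePrimes (s : ℕ) (G : MvPolynomial (Fin 3) K) : Set (Ideal (MvPolynomial (Fin 3) K)) :=
  {P | P.IsPrime ∧ multIdeal s G ≤ P ∧ P ≤ idealOfVars (Fin 3) K ∧ P ≠ idealOfVars (Fin 3) K}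

/-- **Non-isolated multiplicity produces a curve prime.**  If no `g · (y₀y₁y₂)^M` with `g(0) ≠ 0` lies in the
multiplicity ideal, some coordinate submonoid `{g y_i^M}` misses it, and a prime ideal maximal w.r.t. missing that
submonoid is a curve prime. [new; standard commutative algebra] [folklore] -/
theorem curvePrimes_nonempty_of_not_isolatedMult {s : ℕ} {G : MvPolynomial (Fin 3) K} (h : ¬ IsolatedMult s G) :
    (curvePrimes s G).Nonempty := by
  classical
  -- one coordinate has no certificate
  have key : ∃ i : Fin 3, ∀ (M : ℕ) (g : MvPolynomial (Fin 3) K), constantCoeff g ≠ 0 →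
      g * X i ^ M ∉ multIdeal s G := by
    by_contra hall
    push Not at hall
    choose M g hg hmem using hall
    apply h
    refine ⟨M 0 + M 1 + M 2, g 0 * g 1 * g 2, by simp [hg 0, hg 1, hg 2], fun i => ?_⟩
    fin_cases i
    · have : g 0 * g 1 * g 2 * X 0 ^ (M 0 + M 1 + M 2) =
          (g 1 * g 2 * X 0 ^ (M 1 + M 2)) * (g 0 * X (0 : Fin 3) ^ M 0) := by ring
      simpa [this] using Ideal.mul_mem_left _ _ (hmem 0)
    · have : g 0 * g 1 * g 2 * X 1 ^ (M 0 + M 1 + M 2) =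
          (g 0 * g 2 * X 1 ^ (M 0 + M 2)) * (g 1 * X (1 : Fin 3) ^ M 1) := by ring
      simpa [this] using Ideal.mul_mem_left _ _ (hmem 1)
    · have : g 0 * g 1 * g 2 * X 2 ^ (M 0 + M 1 + M 2) =
          (g 0 * g 1 * X 2 ^ (M 0 + M 1)) * (g 2 * X (2 : Fin 3) ^ M 2) := by ring
      simpa [this] using Ideal.mul_mem_left _ _ (hmem 2)
  obtain ⟨i, hi⟩ := key
  let T : Submonoid (MvPolynomial (Fin 3) K) :=
    { carrier := {f | ∃ (M : ℕ) (g : MvPolynomial (Fin 3) K), constantCoeff g ≠ 0 ∧ f = g * X i ^ M}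
      one_mem' := ⟨0, 1, by simp, by simp⟩
      mul_mem' := by
        rintro _ _ ⟨M₁, g₁, hg₁, rfl⟩ ⟨M₂, g₂, hg₂, rfl⟩
        exact ⟨M₁ + M₂, g₁ * g₂, by simp [hg₁, hg₂], by ring⟩ }
  have hdisj : Disjoint (multIdeal s G : Set (MvPolynomial (Fin 3) K)) (T : Set (MvPolynomial (Fin 3) K)) := by
    refine Set.disjoint_left.mpr ?_
    rintro f hf ⟨M, g, hg, rfl⟩
    exact hi M g hg hf
  obtain ⟨P, hP, hIP, hPT⟩ := Ideal.exists_le_prime_disjoint (multIdeal s G) T hdisj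
  refine ⟨P, hP, hIP, fun f hf => ?_, fun hP𝔪 => ?_⟩
  · rw [mem_idealOfVars_iff_constantCoeff]
    by_contra hcc
    exact Set.disjoint_left.mp hPT hf ⟨0, f, hcc, by simp⟩
  · have hX : (X i : MvPolynomial (Fin 3) K) ∈ P := hP𝔪 ▸ X_mem_idealOfVars i
    exact Set.disjoint_left.mp hPT hX ⟨1, 1, by simp, by simp⟩

/-- A NEAR-type certificate at the wall `y_c = 0` (isolated support of `R/(multIdeal + (y_c))`) keeps `y_c` out of
every curve prime: no branch of the order-`s` locus lies inside an old exceptional component. [folklore] -/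
theorem X_not_mem_of_mem_curvePrimes {s : ℕ} {G : MvPolynomial (Fin 3) K} {P : Ideal (MvPolynomial (Fin 3) K)}
    (hP : P ∈ curvePrimes s G) {c : Fin 3}
    (hcert : ∃ (M : ℕ) (g : MvPolynomial (Fin 3) K), constantCoeff g ≠ 0 ∧
      ∀ i, g * X i ^ M ∈ multIdeal s G ⊔ Ideal.span {X c}) :
    X c ∉ P := by
  obtain ⟨hprime, hI, hle, hne⟩ := hP
  intro hXc
  obtain ⟨M, g, hg, hmem⟩ := hcert
  have hsup : multIdeal s G ⊔ Ideal.span {X c} ≤ P :=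
    sup_le hI ((Ideal.span_singleton_le_iff_mem _).mpr hXc)
  have hgP : g ∉ P := fun h => hg ((mem_idealOfVars_iff_constantCoeff g).mp (hle h))
  refine hne (le_antisymm hle (Ideal.span_le.mpr ?_))
  rintro _ ⟨i, rfl⟩
  exact hprime.mem_of_pow_mem M ((hprime.mem_or_mem (hsup (hmem i))).resolve_left hgP)

/-- **Contraction of curve primes down the chain.**  If `σ G = y_j^s G'` and `P'` is a curve prime of `G'` not
containing `y_j`, then `σ⁻¹ P'` is a curve prime of `G`. [new] [folklore] -/
theorem comap_mem_curvePrimes {s : ℕ} {j : Fin 3} {b : Fin 3 → K} (hb : b j = 0)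
    {G G' : MvPolynomial (Fin 3) K} (hG : chartHom j b G = X j ^ s * G')
    {P' : Ideal (MvPolynomial (Fin 3) K)} (hP' : P' ∈ curvePrimes s G') (hXj : X j ∉ P') :
    P'.comap (chartHom j b : MvPolynomial (Fin 3) K →+* MvPolynomial (Fin 3) K) ∈ curvePrimes s G := by
  obtain ⟨hprime, hI', hle', -⟩ := hP'
  haveI := hprime
  refine ⟨Ideal.IsPrime.comap _, multIdeal_le_comap_chartHom hb hG hXj hI', fun f hf => ?_, fun h => ?_⟩
  · rw [Ideal.mem_comap, RingHom.coe_coe] at hf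
    rw [mem_idealOfVars_iff_constantCoeff, ← constantCoeff_chartHom hb f]
    exact (mem_idealOfVars_iff_constantCoeff _).mp (hle' hf)
  · have hX : (X j : MvPolynomial (Fin 3) K) ∈
        P'.comap (chartHom j b : MvPolynomial (Fin 3) K →+* MvPolynomial (Fin 3) K) := h ▸ X_mem_idealOfVars j
    rw [Ideal.mem_comap, RingHom.coe_coe, chartHom_X_self hb] at hX
    exact hXj hX

/-- `y_c ∉ σ⁻¹ P'` for a kept wall `c ≠ j` with `b_c = 0`, provided `y_j, y_c ∉ P'` (`σ y_c = y_j y_c`). [folklore] -/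
theorem X_not_mem_comap_chartHom {j : Fin 3} {b : Fin 3 → K} (hb : b j = 0)
    {P' : Ideal (MvPolynomial (Fin 3) K)} [hP' : P'.IsPrime] (hXj : X j ∉ P') {c : Fin 3} (hcj : c ≠ j)
    (hbc : b c = 0) (hXc : X c ∉ P') :
    X c ∉ P'.comap (chartHom j b : MvPolynomial (Fin 3) K →+* MvPolynomial (Fin 3) K) := by
  rw [Ideal.mem_comap, RingHom.coe_coe, chartHom_X_of_ne hb hcj, hbc, C_0, add_zero]
  exact fun h => (hP'.mem_or_mem h).elim hXj hXc

end Primes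

end Summit.ResolutionOfSingularities.ResolutionOfSingularities.Theorems.NearCut

namespace Summit.ResolutionOfSingularities.ResolutionOfSingularities.Theorems.NearCut

/-! ### §P4 Curve primes are one-dimensional and finitely many; wall intersection lengths -/

section Dimension

variable {K : Type} [Field K]

/-- The image of the closed point in `R/P` is a maximal ideal, for `P ≤ 𝔪`. [folklore] -/
theorem isMaximal_map_idealOfVars {P : Ideal (MvPolynomial (Fin 3) K)} [P.IsPrime]
    (hle : P ≤ idealOfVars (Fin 3) K) :
    ((idealOfVars (Fin 3) K).map (Ideal.Quotient.mk P)).IsMaximal := by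
  have h𝔪 : (idealOfVars (Fin 3) K).IsMaximal := isMaximal_idealOfVars
  refine (Ideal.map_eq_top_or_isMaximal_of_surjective _ Ideal.Quotient.mk_surjective h𝔪).resolve_left ?_
  intro htop
  have := Ideal.comap_map_of_surjective (Ideal.Quotient.mk P) Ideal.Quotient.mk_surjective (idealOfVars (Fin 3) K)
  rw [htop, Ideal.comap_top, ← RingHom.ker_eq_comap_bot, Ideal.mk_ker, sup_eq_left.mpr hle] at this
  exact h𝔪.ne_top this.symm

/-- **Curve primes have one-dimensional quotient.**  A NEAR-type certificate at some wall `y_c` makes the closed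
point minimal over `P + (y_c)`; by Krull's principal ideal theorem the closed point has height `≤ 1` in `R/P`, and
by the equidimensionality of affine domains (`height 𝔪 = dim`) `dim R/P ≤ 1`.  [Krull PIT; AffineDomainEquidim] [folklore] -/
theorem krullDimLE_one_of_mem_curvePrimes {s : ℕ} {G : MvPolynomial (Fin 3) K}
    {P : Ideal (MvPolynomial (Fin 3) K)} (hP : P ∈ curvePrimes s G) {c : Fin 3}
    (hcert : ∃ (M : ℕ) (g : MvPolynomial (Fin 3) K), constantCoeff g ≠ 0 ∧
      ∀ i, g * X i ^ M ∈ multIdeal s G ⊔ Ideal.span {X c}) :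
    Ring.KrullDimLE 1 (MvPolynomial (Fin 3) K ⧸ P) := by
  obtain ⟨hprime, hI, hle, hne⟩ := hP
  haveI := hprime
  have h𝔪 : (idealOfVars (Fin 3) K).IsMaximal := isMaximal_idealOfVars
  have hmin : idealOfVars (Fin 3) K ∈ (P ⊔ Ideal.span {(X c : MvPolynomial (Fin 3) K)}).minimalPrimes := by
    refine ⟨⟨h𝔪.isPrime, sup_le hle ((Ideal.span_singleton_le_iff_mem _).mpr (X_mem_idealOfVars c))⟩, ?_⟩
    rintro q ⟨hq, hPq⟩ hq𝔪
    obtain ⟨M, g, hg, hmem⟩ := hcert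
    have hgq : g ∉ q := fun h => hg ((mem_idealOfVars_iff_constantCoeff g).mp (hq𝔪 h))
    refine Ideal.span_le.mpr ?_
    rintro _ ⟨i, rfl⟩
    have : g * X i ^ M ∈ q := hPq (sup_le_sup_right hI _ (hmem i))
    exact hq.mem_of_pow_mem M ((hq.mem_or_mem this).resolve_left hgq)
  have hht := Ideal.map_height_le_one_of_mem_minimalPrimes hmin
  haveI := isMaximal_map_idealOfVars hle
  have hdim := height_eq_ringKrullDim_of_isMaximal K ((idealOfVars (Fin 3) K).map (Ideal.Quotient.mk P))
  rw [Ring.krullDimLE_iff, ← hdim]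
  exact_mod_cast hht

/-- Curve primes are minimal over the multiplicity ideal (given that all curve primes have one-dimensional
quotient): a smaller prime `Q` would be a curve prime with `Q < P < 𝔪` in the one-dimensional domain `R/Q`. [folklore] -/
theorem mem_minimalPrimes_of_mem_curvePrimes {s : ℕ} {G : MvPolynomial (Fin 3) K}
    (hdim : ∀ Q ∈ curvePrimes s G, Ring.KrullDimLE 1 (MvPolynomial (Fin 3) K ⧸ Q))
    {P : Ideal (MvPolynomial (Fin 3) K)} (hP : P ∈ curvePrimes s G) : P ∈ (multIdeal s G).minimalPrimes := by
  obtain ⟨hprime, hI, hle, hne⟩ := hP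
  refine ⟨⟨hprime, hI⟩, ?_⟩
  rintro Q ⟨hQ, hIQ⟩ hQP
  have hQc : Q ∈ curvePrimes s G := ⟨hQ, hIQ, hQP.trans hle, fun h => hne (le_antisymm hle (h ▸ hQP))⟩
  haveI := hdim Q hQc
  haveI := hQ
  by_contra hPQ
  have hker : RingHom.ker (Ideal.Quotient.mk Q) ≤ P := by rw [Ideal.mk_ker]; exact hQP
  have hPbar : (P.map (Ideal.Quotient.mk Q)).IsPrime := Ideal.map_isPrime_of_surjective Ideal.Quotient.mk_surjective hker
  have hPbar_ne : P.map (Ideal.Quotient.mk Q) ≠ ⊥ := by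
    intro h
    apply hPQ
    intro f hf
    have : Ideal.Quotient.mk Q f ∈ P.map (Ideal.Quotient.mk Q) := Ideal.mem_map_of_mem _ hf
    rwa [h, Ideal.mem_bot, Ideal.Quotient.eq_zero_iff_mem] at this
  have hPbar_max := hPbar.isMaximal_of_ne_bot hPbar_ne
  have h𝔪bar := isMaximal_map_idealOfVars (hQP.trans hle)
  have heq : P.map (Ideal.Quotient.mk Q) = (idealOfVars (Fin 3) K).map (Ideal.Quotient.mk Q) :=
    hPbar_max.eq_of_le h𝔪bar.ne_top (Ideal.map_mono hle)
  apply hne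
  have := congrArg (Ideal.comap (Ideal.Quotient.mk Q)) heq
  rwa [Ideal.comap_map_of_surjective _ Ideal.Quotient.mk_surjective,
    Ideal.comap_map_of_surjective _ Ideal.Quotient.mk_surjective, ← RingHom.ker_eq_comap_bot, Ideal.mk_ker,
    sup_eq_left.mpr hQP, sup_eq_left.mpr (hQP.trans hle)] at this

/-- **Finitely many curve primes** (they are minimal primes of an ideal of a Noetherian ring). [folklore] -/
theorem curvePrimes_finite {s : ℕ} {G : MvPolynomial (Fin 3) K}
    (hdim : ∀ Q ∈ curvePrimes s G, Ring.KrullDimLE 1 (MvPolynomial (Fin 3) K ⧸ Q)) :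
    (curvePrimes s G).Finite :=
  (Ideal.finite_minimalPrimes_of_isNoetherianRing _ (multIdeal s G)).subset
    fun _ hP => mem_minimalPrimes_of_mem_curvePrimes hdim hP

end Dimension

end Summit.ResolutionOfSingularities.ResolutionOfSingularities.Theorems.NearCut
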